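import Mathlib
import Summits.Ventures.PercRepro2.Defs
import Summits.Ventures.PercRepro2.Independence
import Summits.Ventures.PercRepro2.Harris
import Summits.Ventures.PercRepro2.CylinderCond

/-!
# The law of total covariance over a partition into cylinders (blind cell PercRepro2, p1 g13;
the algebra behind PATHMIX «(ii) = Σ_T w_T · Cov(X, Y ∣ T) + PM» — lead g24 00:04Z / 00:15Z)

Setting: a finite family of pairwise disjoint cylinders `cyl T = cylinder (F T) (σ T)` (`T ∈ s`) whose
union is the event `A` (a STOPPING SET: e.g. the exploration records of a canonical exploration that
halts when `a₃ joins`, `A = {a₃ ∈ C₁}`), a conditioning event `Q` and two observables `X, Y`. With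
`p_T = condWeights p (F T) (σ T)` (`CylinderCond.lean`: the law given the cylinder), write

* `c_T = P_p(cyl T)`, `m_T = P_{p_T}(Q)`, `x_T = E_{p_T}[X 1_Q]`, `y_T = E_{p_T}[Y 1_Q]`,
  `z_T = E_{p_T}[X Y 1_Q]` (so `x_T / m_T = E[X ∣ T, Q]` …),
* `M = P_p(A ∩ Q) = Σ_T c_T m_T`, `SX = E_p[X 1_A 1_Q] = Σ_T c_T x_T`, `SY`, `SZ` likewise
  (**`expect_mul_indicator_eq_sum`** — the disintegration of `CylinderCond.lean` summed over the
  partition; `indicator_eq_sum`, `IsCylinderPartition`),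
* the conditional means `x̄_T = x_T / m_T`, …, `X̄ = SX / M`, …, and the weights `w_T = c_T m_T / M`
  (`= P(T ∣ A, Q)`).

**`totalCov`** (the law of total covariance): `Z̄ − X̄ Ȳ = Σ_T w_T (z̄_T − x̄_T ȳ_T) + Σ_T w_T (x̄_T − X̄)(ȳ_T − Ȳ)`
— `Cov(X, Y ∣ A, Q)` is the `w`-average of the within-record covariances plus the between-record
covariance of the conditional means (Lean's `x / 0 = 0` makes the degenerate records `m_T = 0`
contribute `0` on both sides; nonnegative weights are used for that). PATHMIX is this identity for
`X = 1[b ∈ C₂]`, `Y = 1[o ∈ C₂]`, `A = {a₃ ∈ C₁}`: the within part is `≥ 0` termwise by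
`PathMixBHK.givenT_same_cluster`, and `PM = between + drop · slack` (paper, P1-PATH.md §9).
Identities only. -/

namespace Summit.Ventures.PercRepro2

namespace CylinderCov

open CylinderCond

section Sums
variable {E : Type*} [Fintype E] [DecidableEq E] {R : Type*} [CommRing R]

/-- A finite family of pairwise disjoint cylinders whose union is `A`. -/
structure IsCylinderPartition {ι : Type*} (s : Finset ι) (F : ι → Finset E) (σ : ι → Config E)
    (A : Set (Config E)) : Prop where
  cover : ∀ ω ∈ A, ∃ T ∈ s, ω ∈ cylinder (F T) (σ T)
  sub : ∀ T ∈ s, cylinder (F T) (σ T) ⊆ A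
  disj : ∀ T ∈ s, ∀ T' ∈ s, T ≠ T' → Disjoint (cylinder (F T) (σ T)) (cylinder (F T') (σ T'))

variable {ι : Type*} {s : Finset ι} {F : ι → Finset E} {σ : ι → Config E} {A : Set (Config E)}

omit [Fintype E] [DecidableEq E] in
/-- On a cylinder partition of `A`, `1_A = Σ_T 1_{cyl T}` pointwise. -/
lemma indicator_eq_sum (h : IsCylinderPartition s F σ A) (ω : Config E) :
    A.indicator (1 : Config E → R) ω = ∑ T ∈ s, (cylinder (F T) (σ T)).indicator 1 ω := by
  classical
  by_cases hA : ω ∈ A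
  · obtain ⟨T₀, hT₀, hωT₀⟩ := h.cover ω hA
    rw [Set.indicator_of_mem hA, Finset.sum_eq_single T₀]
    · rw [Set.indicator_of_mem hωT₀]
    · intro T hT hne
      exact Set.indicator_of_notMem
        (fun hωT => Set.disjoint_left.1 (h.disj T hT T₀ hT₀ hne) hωT hωT₀) _
    · intro h'; exact absurd hT₀ h'
  · rw [Set.indicator_of_notMem hA]
    symm
    exact Finset.sum_eq_zero fun T hT => Set.indicator_of_notMem (fun hω => hA (h.sub T hT hω)) _

/-- **Disintegration of an expectation over a cylinder partition**:
`E_p[f 1_A] = Σ_T P_p(cyl T) · E_{p_T}[f]`. -/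
theorem expect_mul_indicator_eq_sum (p : E → R) (h : IsCylinderPartition s F σ A)
    (f : Config E → R) :
    expect p (fun ω => f ω * A.indicator 1 ω) =
      ∑ T ∈ s, prob p (cylinder (F T) (σ T)) * expect (condWeights p (F T) (σ T)) f := by
  simp_rw [← expect_mul_cylinder_eq]
  unfold expect
  rw [Finset.sum_comm]
  refine Finset.sum_congr rfl fun ω _ => ?_
  show weight p ω * (f ω * A.indicator 1 ω) =
    ∑ T ∈ s, weight p ω * (f ω * (cylinder (F T) (σ T)).indicator 1 ω)
  rw [indicator_eq_sum h ω, Finset.mul_sum, Finset.mul_sum]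

end Sums

section TotalCov
variable {E : Type*} [Fintype E] [DecidableEq E] {R : Type*} [Field R] [LinearOrder R]
  [IsStrictOrderedRing R]
variable {ι : Type*} {s : Finset ι} {F : ι → Finset E} {σ : ι → Config E} {A : Set (Config E)}

/-- If `E_q[1_Q] = 0` for a probability vector `q`, then `E_q[g 1_Q] = 0` for every `g`. -/
lemma expect_mul_indicator_eq_zero {q : E → R} (hq : IsProbVec q) (Q : Set (Config E))
    (hm : expect q (Q.indicator 1) = 0) (g : Config E → R) :
    expect q (fun ω => g ω * Q.indicator 1 ω) = 0 := by
  unfold expect at hm ⊢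
  have hterm : ∀ ω, weight q ω * Q.indicator (1 : Config E → R) ω = 0 := by
    intro ω
    have hnn : ∀ ω', 0 ≤ weight q ω' * Q.indicator (1 : Config E → R) ω' := fun ω' =>
      mul_nonneg (weight_nonneg hq ω') (Set.indicator_apply_nonneg fun _ => zero_le_one)
    exact (Finset.sum_eq_zero_iff_of_nonneg fun ω' _ => hnn ω').1 hm ω (Finset.mem_univ ω)
  refine Finset.sum_eq_zero fun ω _ => ?_
  calc weight q ω * (g ω * Q.indicator 1 ω) = g ω * (weight q ω * Q.indicator 1 ω) := by ring
    _ = 0 := by rw [hterm ω, mul_zero]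

/-- **The law of total covariance over a cylinder partition** (division form; `x / 0 = 0`).
With `c_T = P_p(cyl T)`, `m_T = E_{p_T}[1_Q]`, `x_T = E_{p_T}[X 1_Q]`, `y_T = E_{p_T}[Y 1_Q]`,
`z_T = E_{p_T}[X Y 1_Q]`, `M = Σ_T c_T m_T`, `SX = Σ_T c_T x_T`, `SY`, `SZ`:
`SZ / M − (SX / M) (SY / M) = Σ_T (c_T m_T / M) (z_T / m_T − (x_T / m_T)(y_T / m_T))
  + Σ_T (c_T m_T / M) (x_T / m_T − SX / M) (y_T / m_T − SY / M)`. -/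
theorem totalCov (p : E → R) (hp : IsProbVec p) (_h : IsCylinderPartition s F σ A)
    (Q : Set (Config E)) (X Y : Config E → R) (hM : 0 < ∑ T ∈ s, prob p (cylinder (F T) (σ T)) *
      expect (condWeights p (F T) (σ T)) (Q.indicator 1)) :
    let c : ι → R := fun T => prob p (cylinder (F T) (σ T))
    let m : ι → R := fun T => expect (condWeights p (F T) (σ T)) (Q.indicator 1)
    let x : ι → R := fun T => expect (condWeights p (F T) (σ T)) (fun ω => X ω * Q.indicator 1 ω)
    let y : ι → R := fun T => expect (condWeights p (F T) (σ T)) (fun ω => Y ω * Q.indicator 1 ω)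
    let z : ι → R := fun T => expect (condWeights p (F T) (σ T))
      (fun ω => X ω * Y ω * Q.indicator 1 ω)
    let M : R := ∑ T ∈ s, c T * m T
    let SX : R := ∑ T ∈ s, c T * x T
    let SY : R := ∑ T ∈ s, c T * y T
    let SZ : R := ∑ T ∈ s, c T * z T
    SZ / M - (SX / M) * (SY / M) =
      (∑ T ∈ s, (c T * m T / M) * (z T / m T - (x T / m T) * (y T / m T))) +
        ∑ T ∈ s, (c T * m T / M) * (x T / m T - SX / M) * (y T / m T - SY / M) := by
  intro c m x y z M SX SY SZ
  have hM0 : M ≠ 0 := ne_of_gt hM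
  -- per-record: `c m / M · (z / m) = c z / M` etc. (degenerate records contribute `0` on both sides)
  have key : ∀ T ∈ s, (c T * m T / M) * (z T / m T) = c T * z T / M ∧
      (c T * m T / M) * (x T / m T) = c T * x T / M ∧
      (c T * m T / M) * (y T / m T) = c T * y T / M ∧
      (c T * m T / M) * ((x T / m T) * (y T / m T)) = c T * x T * y T / (m T * M) := by
    intro T _
    by_cases hm : m T = 0
    · have hq := isProbVec_condWeights hp (F T) (σ T)
      have hx : x T = 0 := expect_mul_indicator_eq_zero hq Q hm X
      have hy : y T = 0 := expect_mul_indicator_eq_zero hq Q hm Y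
      have hz : z T = 0 := expect_mul_indicator_eq_zero hq Q hm (fun ω => X ω * Y ω)
      simp [hm, hx, hy, hz]
    · refine ⟨?_, ?_, ?_, ?_⟩
      all_goals field_simp
  -- sums of the per-record identities
  have e1 : ∑ T ∈ s, (c T * m T / M) * (z T / m T) = SZ / M := by
    rw [Finset.sum_div]
    exact Finset.sum_congr rfl fun T hT => (key T hT).1
  have e2 : ∑ T ∈ s, (c T * m T / M) * (x T / m T) = SX / M := by
    rw [Finset.sum_div]
    exact Finset.sum_congr rfl fun T hT => (key T hT).2.1
  have e3 : ∑ T ∈ s, (c T * m T / M) * (y T / m T) = SY / M := by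
    rw [Finset.sum_div]
    exact Finset.sum_congr rfl fun T hT => (key T hT).2.2.1
  have e0 : ∑ T ∈ s, (c T * m T / M) = 1 := by
    rw [← Finset.sum_div]
    exact div_self hM0
  -- expand the right-hand side
  have expand : ∀ T ∈ s,
      (c T * m T / M) * (z T / m T - (x T / m T) * (y T / m T)) +
        (c T * m T / M) * (x T / m T - SX / M) * (y T / m T - SY / M) =
      (c T * m T / M) * (z T / m T) - (SX / M) * ((c T * m T / M) * (y T / m T)) -
        (SY / M) * ((c T * m T / M) * (x T / m T)) + (SX / M) * (SY / M) * (c T * m T / M) := by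
    intro T _
    ring
  rw [← Finset.sum_add_distrib, Finset.sum_congr rfl expand, Finset.sum_add_distrib,
    Finset.sum_sub_distrib, Finset.sum_sub_distrib, ← Finset.mul_sum, ← Finset.mul_sum,
    ← Finset.mul_sum, e1, e2, e3, e0]
  ring

end TotalCov

end CylinderCov

end Summit.Ventures.PercRepro2
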